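import Literature.Probability.RandomPlanarGeometry.SAWPulledEnsembleEquivalence
import Literature.Probability.RandomPlanarGeometry.SAWPolygonGrowth
import HarnessLib

/-!
# Beaton 2015, Theorem 1 (the critical pulling force is `y_c = 1`) for Beaton's own ensemble — pulled
# self-avoiding walks in the WEAK half-space: the free energy exists and exceeds `log μ` for every `y > 1`
# (every dimension) and EQUALS `log μ` for `0 < y ≤ 1` (every dimension `≥ 2`; appended); and
# Janse van Rensburg–Whittington 2016, Theorem 3, for the PRINTED triple of ensembles `C` (span weight),
# `C⁺` (height weight), `B` (bridges)

Topic `Literature/Probability/RandomPlanarGeometry` (continues `SAWPulledEnsembleEquivalence.lean` — the three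
pulled ensembles bridges / M–S half-space walks / drifted walks have ONE free energy `λ_B` for `y ≥ 1`, with the
sandwich transfer `Zd.tendsto_log_sum_pow_div` —, `SAWPulledBridgeFreeEnergy.lean` — `λ_B = Zd.pulledBridgeFreeEnergy`
exists (Fekete) and `log(μ + e^{-2/(y-1)}) ≤ λ_B(y)` for `y > 1` — and `SAWPulledBridgeGain.lean`; the appended
pushed phase uses `SAWPolygonGrowth.lean` — `μ_Polygon = μ` in every `d ≥ 2`, `Zd.exp_mul_pow_le_card_saLoops` — and the
closed self-avoiding loops `Zd.saLoops` / `Zd.loopTrunc` of `SAWKestenBound.lean`).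

Source: N. R. Beaton, *The critical pulling force for self-avoiding walks*, J. Phys. A: Math. Theor. 48 (2015)
16FT03 (arXiv:1407.1917), §2, AS PRINTED (held text `paper:arxiv-1407.1917`, p0003): "Let `L = ℤ^d` be the
`d`-dimensional hypercubic lattice … Let `ℍ = ℤ^{d-1} × ℤ^{≥0}` be a half-space of `L`. Let `c_n` be the number of
`n`-step self-avoiding walks on `L`, starting at the origin, and let `u_n ≤ c_n` be the number of those walks which
also stay entirely in `ℍ`" (L3); "We define the height `h` of a walk `γ` of length `n` to be the difference between
the `z`-coordinates of its first and last vertices … `U_n(y) = Σ_{h≥0} u_n(h) y^h`" (L17–L20); "It is proved in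
[vanRensburg2009Thermodynamics] that the free energy `λ(y) = lim_{n→∞} n^{-1} log U_n(y)` exists" (L21–L22);
(3) "`λ(y) = κ` for `0 ≤ y ≤ 1`" (L27); (4) "`λ(y) ≥ log y`" (L32); "there is a critical value `y_c ≥ 1` of `y` …
`λ(y) = κ` for `0 ≤ y ≤ y_c`, `> κ` for `y > y_c`" (L34–L35); **Theorem 1 (L39–L40): "The critical fugacity `y_c`
for pulled SAWs in a half-space of the `d`-dimensional hypercubic lattice is `y_c = 1`."** The content proved in
Beaton's §3 is the strict inequality `λ(y) > κ` for `y > 1` (via bridges, eq. (8)); eq. (3) is quoted from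
[Hammersley1982] / [Hammersley–Whittington 1985].

Second source: E. J. Janse van Rensburg, S. G. Whittington, *Self-avoiding walks subject to a force*, J. Phys. A:
Math. Theor. 49 (2016) 11LT01 (arXiv:1510.06698, held text `paper:arxiv-1510.06698`), AS PRINTED: p. 3 "self-avoiding
walks starting at the origin and with no vertices having negative `x_d`-coordinate. These are called positive walks.
… `c_n^+(v,h)` is the number of `n`-edge positive walks with `v+1` vertices in `x_d = 0` and with the `x_d`-coordinate
of their last vertex equal to `h` … `C⁺_n(a,y) = Σ_{v,h} c_n^+(v,h) a^v y^h` … `c_n(v,s)` is the number of `n`-edge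
positive walks with `v+1` vertices in the surface and with span in the `x_d`-direction equal to `s` …
`C_n(a,y) = Σ_{v,s} c_n(v,s) a^v y^s`"; p. 4 "`C⁺(y,z) = Σ_n C⁺_n(1,y) zⁿ`, `C(y,z) = Σ_n C_n(1,y) zⁿ` … Let `b_n(h)`
be the number of `n`-edge bridges with the `x_d`-coordinate of the last vertex being `h`"; **Theorem 3 (p. 4;
p0005:L22–L24): "The radii of convergence of the generating functions `C(y,z)`, `C⁺(y,z)` and `B(y,z)` are all equal
when `y ≥ 1`."** Printed proof (p0005:L26–L49): "`B(y,z) ≤ C⁺(y,z) ≤ C(y,z)`, `y > 1`" by inclusion and `s ≥ h`;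
"Each walk counted by `C(y,z)` can be converted to a bridge by unfolding in the `x_d`-direction and at most
`e^{O(√n)}` such walks give the same bridge [HammersleyWelsh]. Moreover the span can not decrease in the unfolding
operation so, for `y > 1`, `C_n(1,y) ≤ e^{O(√n)} B_n(y)`." (Positive walks = Beaton's weak-half-space walks;
`C⁺_n(1,y)` = Beaton's `U_n(y)`.)

## What is here

* Beaton's objects as definitions with bodies (coordinate `0` in place of `z = x^{(d)}`; bodies VERBATIM those of the
  lane's typed audit file `PcvSawmu.AsPrinted.Beaton2015` by lit-1, `rfl`-checked there): `Zd.weakHalfSpaceWalks d n`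
  (the `n`-step SAWs from `0` with `x₁ ≥ 0` throughout — `u_n = #`), `Zd.pulledU d n y = U_n(y) = Σ_ω y^{x₁(ω_n)}`.
* The sandwich `Z^B_n(y) ≤ U_n(y) ≤ Z_n(log y)` (`pulledBridgeZ_le_pulledU`, `pulledU_le_driftZ`): bridges are weak
  half-space walks, which are walks.
* **`Zd.tendsto_log_pulledU_div`** — for `y ≥ 1`, `n^{-1} log U_n(y) → λ_B(y)` (every dimension): Beaton's free
  energy `λ(y)` EXISTS on `y ≥ 1` (the printed standing fact, there attributed to [vanRensburg2009Thermodynamics],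
  becomes a theorem on this range) and equals the bridge free energy (Janse van Rensburg–Whittington 2016, Thm 3).
* **`Zd.Beaton2015_thm1_gt_one`** — THEOREM 1, supercritical clause, AS PRINTED (the shape of the lane's typed
  `Thm1_AsPrinted`, second conjunct): for every `y > 1` there is `λ > log μ` with `n^{-1} log U_n(y) → λ`; and the
  explicit form `Zd.Beaton2015_thm1_gt_one_explicit`: `λ = λ_B(y) ≥ log(μ + e^{-2/(y-1)})` (the lane's explicit gain,
  `SAWPulledBridgeGain.lean` / `SAWPulledBridgeFreeEnergy.lean`).
* JvR–W's span-weighted ensemble as a definition with body: `Zd.pulledSpanU d n y = C_n(1,y) = Σ_ω y^{span ω}` over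
  the positive walks (`span ω = maxLevel n ω`, the minimum level being `x₁(ω_0) = 0`); the printed inequalities
  `B_n(y) ≤ C⁺_n(1,y) ≤ C_n(1,y)` for `y ≥ 1` (`pulledBridgeZ_le_pulledU`, `pulledU_le_pulledSpanU`); "the span can
  not decrease in the unfolding" (`maxLevel_le_unfold_last`); the unfolding bound with the tree's explicit code count,
  **`Zd.pulledSpanU_le_exp_mul_driftZ`**: `C_n(1,y) ≤ e^{3√n} Z_n(log y)` (image of the unfolding compared with the
  drift ensemble) and, chained with `Zd.driftZ_le_mul_exp_mul_pulledBridgeZ_succ`, the printed shape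
  **`Zd.pulledSpanU_le_mul_pulledBridgeZ_succ`**: `C_n(1,y) ≤ (n+1) e^{3√n + 6√(n+1)} Z^B_{n+1}(y)`;
  **`Zd.tendsto_log_pulledSpanU_div`**: `n⁻¹ log C_n(1,y) → λ_B(y)` for `y ≥ 1`.
* **`Zd.JansevanRensburgWhittington2016_thm3`** — THEOREM 3 AS PRINTED for the printed triple: for `y ≥ 1` the three
  series `Σ_n C_n(1,y) zⁿ`, `Σ_n C⁺_n(1,y) zⁿ` (`= Σ_n U_n(y) zⁿ`), `Σ_n B_n(y) zⁿ` converge for `0 ≤ z < e^{-λ_B(y)}`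
  and diverge for `z > e^{-λ_B(y)}` — equal radii (Cauchy–Hadamard from the three free-energy limits). (The tree's
  strict-half-space and drift ensembles: `Zd.JansevanRensburgWhittington2016_thm3_bridge_height`,
  `SAWPulledEnsembleEquivalence.lean`.)

Deviations (labelled): pulled direction = coordinate `0` (printed `x_d`); the sub-exponential factor is the tree's
explicit `e^{3√n}` (printed `e^{O(√n)}`); the unfolding image of a positive walk is compared with the full-space drift
ensemble `Z_n(log y)` rather than directly with bridges (a positive walk that revisits the surface unfolds to a walk
with maximal endpoint level, a bridge only after one extra initial step — whence the printed-shape bound at length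
`n + 1`); radii are obtained from the free energies (all equal to `λ_B`) instead of the printed direct comparison.

* (appended) **The pushed phase, eq. (3), for `0 < y ≤ 1`, every dimension `d + 2 ≥ 2`**:
  **`Zd.tendsto_log_pulledU_div_of_le_one`** — `n⁻¹ log U_n(y) → log μ`. Lower bound by OPENING THE SELF-AVOIDING
  POLYGONS AT A LOWEST POINT (the printed mechanism of Madras–Slade's Proposition 8.1.2, p. 261: a polygon rooted at a
  point of minimal `x₁` lies in `x₁ ≥ 0` and opens to a self-avoiding walk ending at a unit vector): `Zd.rerootOpen`,
  `Zd.openAtMin` (defs), `rerootOpen_mem_saws`, `rerootOpen_apply_zero_nonneg`, `rerootOpen_last_adj`,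
  `eq_of_rerootOpen_eq` (at most `a` rooted oriented polygons per opened walk), `mul_card_saLoops_le_mul_pulledU`
  (`y · #saLoops(a) ≤ a · U_{a-1}(y)`), `sq_mul_card_saLoops_le_mul_pulledU` (even lengths: one more step dropped,
  `y² · #saLoops(a) ≤ a 3^d U_{a-2}(y)`), `pulledU_lower_of_le_one` (`y² μ^{n-2} e^{-C√n}/((n+2)3^d) ≤ U_n(y)`, `n ≥ 3`,
  from `μ^{2M} e^{-C√M} ≤ #saLoops(2M+2)`); upper bound `U_n(y) ≤ c_n` (`pulledU_le_count`) and `c_n^{1/n} → μ`.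
* (appended) **`Zd.Beaton2015_thm1`** — THEOREM 1 AS PRINTED IN FULL ("`y_c = 1`"), every `ℤ^{d+2}`: for `0 < y ≤ 1`
  the free energy is `log μ`, and for every `y > 1` it exists and is `> log μ`.
* (appended) Beaton's §2 standing facts as theorems: `pow_le_pulledBridgeZ`
  (`Z^B_n(y) ≥ yⁿ`), `pulledBridgeZ_mono_right`, `log_le_pulledBridgeFreeEnergy` (`log y ≤ λ_B(y)`),
  `pulledBridgeFreeEnergy_mono`, `pulledBridgeFreeEnergy_one` (`λ_B(1) = log μ`: the two phases agree at `y_c`),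
  **`Zd.Beaton2015_freeEnergy`** — the free energy EXISTS for every `y > 0` and equals `max(log μ, λ_B(y))` (the
  printed "the free energy exists [vanRensburg2009Thermodynamics]" and the phase picture (5)),
  `Beaton2015_freeEnergy_exists`, `Beaton2015_eq4` (`λ(y) ≥ log y`, eq. (4)).

NOT proved here (printed only): eq. (3) at the single value `y = 0` (`U_n(0) = u_n(0)`, walks ending exactly on the
surface; [Hammersley1982] as quoted by Beaton) and dimension `d = 1` (where `U_n(y) = yⁿ` and eq. (3) is false);
Beaton's printed route to (3) is `λ(1) = κ`, `λ(0) = κ` and monotonicity — here each `y ∈ (0,1]` is sandwiched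
directly. The BRIDGE pushed phase (`λ_B(y) = log μ` for `y ≤ 1`, Janse van Rensburg–Whittington 2016 Thm 1; bridges of
bounded span) is not covered by the polygon argument and is not claimed.

Tree-twin search: `grep -rn "weakHalfSpace\|pulledU\|pulledSpan\|Beaton2015, Theorem 1\|1510.06698" Literature/` →
`SAWUnfolding*.lean` (`weakHalfSpace_iterate_unfoldStep`, a hypothesis-level predicate, no finset),
`SAWPulledBridgeGain.lean` (bridges / strict half-space only), `SAWPulledEnsembleEquivalence.lean` (Theorem 3 for the
tree's bridge / strict-half-space / drift ensembles and the sandwich theorem used here). No twin of `U_n`, `C_n(1,y)`.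
-/

noncomputable section

open Finset Filter Topology Literature.Probability.LatticeModels
open Literature.Probability.RandomPlanarGeometry.SAW
open scoped BigOperators

namespace Literature.Probability.RandomPlanarGeometry.SAW.Zd

/-! ## Beaton's objects -/

open Classical in
/-- **Beaton's weak-half-space walks**: the `n`-step self-avoiding walks from the origin that "stay entirely in
`ℍ = ℤ^{d-1} × ℤ^{≥0}`", i.e. `x₁(ω_i) ≥ 0` for all `i ≤ n` (coordinate `0` for Beaton's `z`); `u_n` is its
cardinality. (Contrast the tree's `halfSpaceWalks` = Madras–Slade half-space walks, `x₁(ω_i) > 0` for `i ≥ 1`.)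
Body verbatim as the lane's typed object `PcvSawmu.AsPrinted.Beaton2015.weakHalfSpaceWalks` (lit-1).
[cite: Beaton2015, §2 (p. 3: "let u_n ≤ c_n be the number of those walks which also stay entirely in ℍ")] -/
def weakHalfSpaceWalks (d : ℕ) [NeZero d] (n : ℕ) : Finset (ℕ → Site d) :=
  (saws d n).filter fun ω => ∀ i, i ≤ n → 0 ≤ ω i 0

/-- **Beaton's partition function `U_n(y) = Σ_{h ≥ 0} u_n(h) y^h`**, written walk by walk as `Σ_ω y^{x₁(ω_n)}`
(the height `h = x₁(ω_n) - x₁(ω_0) = x₁(ω_n) ≥ 0`). Body verbatim as `PcvSawmu.AsPrinted.Beaton2015.pulledU` (lit-1).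
[cite: Beaton2015, §2 (p. 3: "U_n(y) = Σ_{h≥0} u_n(h) y^h")] -/
def pulledU (d : ℕ) [NeZero d] (n : ℕ) (y : ℝ) : ℝ :=
  ∑ ω ∈ weakHalfSpaceWalks d n, y ^ (ω n 0).toNat

variable {d : ℕ} [NeZero d]

/-- Membership in `weakHalfSpaceWalks`. [cite: Beaton2015, §2 (p. 3)] -/
theorem mem_weakHalfSpaceWalks {n : ℕ} {ω : ℕ → Site d} :
    ω ∈ weakHalfSpaceWalks d n ↔ ω ∈ saws d n ∧ ∀ i, i ≤ n → 0 ≤ ω i 0 := by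
  classical
  exact Finset.mem_filter

/-- `u_n ≤ c_n`: weak-half-space walks are self-avoiding walks. [cite: Beaton2015, §2 (p. 3: "u_n ≤ c_n")] -/
theorem weakHalfSpaceWalks_subset_saws (n : ℕ) : weakHalfSpaceWalks d n ⊆ saws d n := fun _ hω =>
  (mem_weakHalfSpaceWalks.1 hω).1

/-- Madras–Slade half-space walks (`x₁ > 0` after time `0`) are weak-half-space walks.
[cite: Beaton2015, §2 (p. 3); MadrasSlade1993, Definition 3.1.2] -/
theorem halfSpaceWalks_subset_weakHalfSpaceWalks (n : ℕ) : halfSpaceWalks d n ⊆ weakHalfSpaceWalks d n := by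
  intro ω hω
  obtain ⟨hs, hh⟩ := mem_halfSpaceWalks.1 hω
  obtain ⟨h0, -, -, -⟩ := mem_saws.1 hs
  refine mem_weakHalfSpaceWalks.2 ⟨hs, fun i hi => ?_⟩
  rcases Nat.eq_zero_or_pos i with rfl | hipos
  · rw [h0]; exact le_rfl
  · have h := hh i hipos hi
    rw [h0] at h
    exact le_of_lt h

/-- Bridges are weak-half-space walks ("bridges are a subset of upper half-plane walks").
[cite: Beaton2015, §3 (p. 4: "bridges are a subset of upper half-plane walks, so U(z,y) ≥ B(z,y)")] -/
theorem bridges_subset_weakHalfSpaceWalks (n : ℕ) : bridges d n ⊆ weakHalfSpaceWalks d n :=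
  (bridges_subset_halfSpaceWalks n).trans (halfSpaceWalks_subset_weakHalfSpaceWalks n)

/-- Endpoint heights of weak-half-space walks are `≥ 0`. [cite: Beaton2015, §2 (p. 3: "Σ_{h≥0}")] -/
theorem apply_last_nonneg_of_mem_weakHalfSpaceWalks {n : ℕ} {ω : ℕ → Site d}
    (hω : ω ∈ weakHalfSpaceWalks d n) : 0 ≤ ω n 0 :=
  (mem_weakHalfSpaceWalks.1 hω).2 n le_rfl

/-! ## The sandwich `Z^B_n ≤ U_n ≤ Z_n` -/

/-- `Z^B_n(y) ≤ U_n(y)` for `y ≥ 0`. [cite: Beaton2015, §3 (p. 4: "U(z,y) ≥ B(z,y)")] -/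
theorem pulledBridgeZ_le_pulledU (n : ℕ) {y : ℝ} (hy : 0 ≤ y) : pulledBridgeZ d n y ≤ pulledU d n y :=
  pulledBridgeZ_le_sum_pow_of_bridges_subset (bridges_subset_weakHalfSpaceWalks n) hy

/-- `U_n(y) ≤ Z_n(log y)` for `y > 0` (weak-half-space walks are walks; `y^h = e^{(log y) h}`).
[cite: JansevanRensburgWhittington2016, Theorem 3 (proof: inclusions); Beaton2015, §2] -/
theorem pulledU_le_driftZ (n : ℕ) {y : ℝ} (hy : 0 < y) : pulledU d n y ≤ driftZ d n (Real.log y) := by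
  have h := sum_pow_le_driftZ_of_subset (weakHalfSpaceWalks_subset_saws (d := d) n)
    (fun ω hω => apply_last_nonneg_of_mem_weakHalfSpaceWalks hω) (Real.log y)
  rwa [Real.exp_log hy] at h

end Zd

/-! ## Beaton's free energy exists for `y ≥ 1` and Theorem 1's supercritical clause -/

namespace Zd

variable {d : ℕ}

/-- **Beaton's free energy exists for `y ≥ 1` and equals the bridge free energy**:
`n^{-1} log U_n(y) → λ_B(y)` in every dimension `d + 1 ≥ 1` (the printed standing fact "the free energy
`λ(y) = lim n^{-1} log U_n(y)` exists" on the range `y ≥ 1`, by the sandwich `Z^B_n ≤ U_n ≤ Z_n` and the equality of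
the bridge and drifted free energies).
[cite: Beaton2015, §2 (p. 3, L21–L22: existence of λ(y)); JansevanRensburgWhittington2016, Theorem 3] -/
theorem tendsto_log_pulledU_div (d : ℕ) {y : ℝ} (hy : 1 ≤ y) :
    Tendsto (fun n : ℕ => Real.log (pulledU (d + 1) n y) / n) atTop
      (𝓝 (pulledBridgeFreeEnergy (d + 1) y)) := by
  have hy0 : 0 < y := zero_lt_one.trans_le hy
  have hθ : 0 ≤ Real.log y := Real.log_nonneg hy
  have h := tendsto_log_sum_pow_div d hθ (fun N => weakHalfSpaceWalks (d + 1) N)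
    (fun N => weakHalfSpaceWalks_subset_saws N) (fun N => bridges_subset_weakHalfSpaceWalks N)
    (fun N ω hω => apply_last_nonneg_of_mem_weakHalfSpaceWalks hω)
  rw [Real.exp_log hy0] at h
  exact h

/-- **Beaton 2015, Theorem 1 (`y_c = 1`), supercritical clause, AS PRINTED** — "`λ(y) > κ` for `y > y_c`" with
`y_c = 1`: for every `y > 1` the free energy of pulled weak-half-space walks exists and is STRICTLY larger than
`log μ`; every dimension `d + 1 ≥ 1`. (The shape is the second conjunct of the lane's typed `Thm1_AsPrinted`; the
clause `λ(y) = κ` for `0 ≤ y ≤ 1`, eq. (3), is printed and not proved here.)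
[cite: Beaton2015, Theorem 1 (p. 3, L39–L40) and its proof, §3, eq. (8)] -/
theorem Beaton2015_thm1_gt_one (d : ℕ) :
    ∀ y : ℝ, 1 < y → ∃ lam : ℝ, Real.log (connectiveConstant (d + 1)) < lam ∧
      Tendsto (fun n : ℕ => Real.log (pulledU (d + 1) n y) / n) atTop (𝓝 lam) := by
  intro y hy
  refine ⟨pulledBridgeFreeEnergy (d + 1) y, ?_, tendsto_log_pulledU_div d hy.le⟩
  have hμ := connectiveConstant_pos (d + 1)
  have h1 := log_connectiveConstant_add_exp_le_pulledBridgeFreeEnergy d hy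
  have h2 : Real.log (connectiveConstant (d + 1)) <
      Real.log (connectiveConstant (d + 1) + Real.exp (-(2 / (y - 1)))) :=
    Real.log_lt_log hμ (lt_add_of_pos_right _ (Real.exp_pos _))
  exact h2.trans_le h1

/-- **Theorem 1, supercritical clause, EXPLICIT**: for `y > 1`, `n^{-1} log U_n(y) → λ_B(y)` and
`log(μ + e^{-2/(y-1)}) ≤ λ_B(y)` — Beaton's `λ(y) > log μ` with the lane's explicit gain (not in print).
[cite: Beaton2015, Theorem 1 and its proof, eq. (8) (qualitative); JansevanRensburgWhittington2013, §3.2 "Bounds on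
λ(y)", display `max{log μ_d, log y} ≤ λ(y) ≤ log μ_d + log y` (arXiv:1307.6457 p. 8, L10–L13: the printed explicit state)] -/
theorem Beaton2015_thm1_gt_one_explicit (d : ℕ) {y : ℝ} (hy : 1 < y) :
    Tendsto (fun n : ℕ => Real.log (pulledU (d + 1) n y) / n) atTop (𝓝 (pulledBridgeFreeEnergy (d + 1) y)) ∧
      Real.log (connectiveConstant (d + 1) + Real.exp (-(2 / (y - 1)))) ≤ pulledBridgeFreeEnergy (d + 1) y :=
  ⟨tendsto_log_pulledU_div d hy.le, log_connectiveConstant_add_exp_le_pulledBridgeFreeEnergy d hy⟩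

end Zd


/-! ## The span-weighted positive-walk ensemble `C_n(1,y)` and Janse van Rensburg–Whittington 2016, Theorem 3
## for the PRINTED triple `C`, `C⁺`, `B` -/

namespace Zd

section Span

open Literature.Combinatorics.Enumerative

variable {d : ℕ} [NeZero d]

/-- **Janse van Rensburg–Whittington's span-weighted partition function `C_n(1,y) = Σ_s c_n(s) y^s`** of positive
walks, AS PRINTED (arXiv:1510.06698 p. 3: "`c_n(v,s)` is the number of `n`-edge positive walks with `v+1` vertices in
the surface and with span in the `x_d`-direction equal to `s` … `C_n(a,y) = Σ_{v,s} c_n(v,s) a^v y^s`", at `a = 1`),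
written walk by walk: positive walks ("no vertices having negative `x_d`-coordinate", p. 3) are Beaton's
weak-half-space walks `weakHalfSpaceWalks` (pulled coordinate `0` here), and the span
`max_i x₁(ω_i) - min_i x₁(ω_i)` of a positive walk from the origin is its maximal level `maxLevel n ω`
(the minimum is `x₁(ω_0) = 0`).
[cite: JansevanRensburgWhittington2016, §1 (p. 3, C_n(a,y)) and §2 (p. 4, "C(y,z) = Σ_n C_n(1,y) zⁿ")] -/
def pulledSpanU (d : ℕ) [NeZero d] (n : ℕ) (y : ℝ) : ℝ :=
  ∑ ω ∈ weakHalfSpaceWalks d n, y ^ (maxLevel n ω).toNat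

/-- `C_n(1,y) ≥ 0` for `y ≥ 0`. [cite: JansevanRensburgWhittington2016, §1 (p. 3)] -/
theorem pulledSpanU_nonneg (n : ℕ) {y : ℝ} (hy : 0 ≤ y) : 0 ≤ pulledSpanU d n y :=
  Finset.sum_nonneg fun _ _ => pow_nonneg hy _

/-- The minimum level of a positive walk from the origin is `0`, so its span is `maxLevel n ω - 0 ≥ 0`.
[cite: JansevanRensburgWhittington2016, §1 (p. 3: "span in the x_d-direction")] -/
theorem maxLevel_nonneg_of_mem_weakHalfSpaceWalks {n : ℕ} {ω : ℕ → Site d}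
    (hω : ω ∈ weakHalfSpaceWalks d n) : 0 ≤ maxLevel n ω ∧ ∀ i, i ≤ n → 0 ≤ ω i 0 ∧ ω i 0 ≤ maxLevel n ω :=
  ⟨(maxLevel_mem_Icc (weakHalfSpaceWalks_subset_saws n hω)).1,
    fun _ hi => ⟨(mem_weakHalfSpaceWalks.1 hω).2 _ hi, apply_le_maxLevel ω hi⟩⟩

/-- **`C⁺_n(1,y) ≤ C_n(1,y)` for `y ≥ 1`** ("the span of a walk is always at least as large as the height of its
last vertex (`s ≥ h`)"; `C⁺_n(1,y)` = Beaton's `U_n(y)` = `pulledU`).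
[cite: JansevanRensburgWhittington2016, Theorem 3 (proof, "C⁺(y,z) ≤ C(y,z) when y > 1")] -/
theorem pulledU_le_pulledSpanU (n : ℕ) {y : ℝ} (hy : 1 ≤ y) : pulledU d n y ≤ pulledSpanU d n y := by
  unfold pulledU pulledSpanU
  exact Finset.sum_le_sum fun ω _ => pow_le_pow_right₀ hy (Int.toNat_le_toNat (apply_le_maxLevel ω le_rfl))

/-- **`B_n(y) ≤ C_n(1,y)` for `y ≥ 1`** (by inclusion and `s ≥ h`).
[cite: JansevanRensburgWhittington2016, Theorem 3 (proof, "B(y,z) ≤ C(y,z) by inclusion")] -/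
theorem pulledBridgeZ_le_pulledSpanU (n : ℕ) {y : ℝ} (hy : 1 ≤ y) : pulledBridgeZ d n y ≤ pulledSpanU d n y :=
  (pulledBridgeZ_le_pulledU n (zero_le_one.trans hy)).trans (pulledU_le_pulledSpanU n hy)

/-- **"The span can not decrease in the unfolding operation"**: `max_i x₁(ω_i) ≤ x₁((unfold ω)_n)`.
[cite: JansevanRensburgWhittington2016, Theorem 3 (proof); MadrasSlade1993, §3.1 (proof of Proposition 3.1.5)] -/
theorem maxLevel_le_unfold_last {n : ℕ} {ω : ℕ → Site d} (hω : ω ∈ saws d n) :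
    maxLevel n ω ≤ unfold n ω n 0 := by
  have h1 : (((code n ω).sum id : ℕ) : ℤ) ≤ unfold n ω n 0 - maxLevel n ω := code_sum_le_span hω
  have h2 : (0 : ℤ) ≤ (((code n ω).sum id : ℕ) : ℤ) := Nat.cast_nonneg _
  linarith

/-- **`C_n(1,y) ≤ #{codes} · Z_n(log y)` for `y ≥ 1`**: group the positive walks by their unfolding code; on each
code class `ω ↦ unfold ω` is injective into the walks whose endpoint level is maximal (hence `≥ 0`), and the span
weight `y^{span ω}` is at most the endpoint weight `y^{x₁((unfold ω)_n)}` of the image (the printed "each walk counted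
by `C(y,z)` can be converted to a bridge by unfolding … at most `e^{O(√n)}` such walks give the same bridge … the
span can not decrease"; here the image is compared with the full-space drift ensemble `Z_n(log y)`, whose free
energy is `λ_B` by `tendsto_log_driftZ_div`).
[cite: JansevanRensburgWhittington2016, Theorem 3 (proof); MadrasSlade1993, §3.1, eqs. (3.1.4)–(3.1.5)] -/
theorem pulledSpanU_le_card_mul_driftZ (n : ℕ) {y : ℝ} (hy : 1 ≤ y) :
    pulledSpanU d n y ≤ ((finsetsOfSumLE n).card : ℝ) * driftZ d n (Real.log y) := by
  classical
  have hy0 : 0 < y := zero_lt_one.trans_le hy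
  have hW : weakHalfSpaceWalks d n ⊆ saws d n := weakHalfSpaceWalks_subset_saws n
  -- (1) termwise: the span is at most the span of the unfolding
  have step1 : pulledSpanU d n y ≤ ∑ ω ∈ weakHalfSpaceWalks d n, y ^ (unfold n ω n 0).toNat := by
    unfold pulledSpanU
    exact Finset.sum_le_sum fun ω hω =>
      pow_le_pow_right₀ hy (Int.toNat_le_toNat (maxLevel_le_unfold_last (hW hω)))
  -- (2) reindex by `(unfold ω, code ω)`, injective on self-avoiding walks
  let F : (ℕ → Site d) → (ℕ → Site d) × Finset ℕ := fun ω => (unfold n ω, code n ω)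
  have hinj : Set.InjOn F ↑(weakHalfSpaceWalks d n) := fun ω hω ω' hω' h =>
    unfold_code_injOn n (hW hω) (hW hω') h
  have step2 : ∑ ω ∈ weakHalfSpaceWalks d n, y ^ (unfold n ω n 0).toNat =
      ∑ p ∈ (weakHalfSpaceWalks d n).image F, y ^ (p.1 n 0).toNat := by
    rw [Finset.sum_image hinj]
  -- (3) the image lies in `{walks with endpoint level ≥ 0} × codes`
  set T : Finset (ℕ → Site d) := (saws d n).filter fun β => 0 ≤ β n 0 with hT
  have hTs : T ⊆ saws d n := Finset.filter_subset _ _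
  have hTpos : ∀ β ∈ T, 0 ≤ β n 0 := fun β hβ => (Finset.mem_filter.1 hβ).2
  have hsub : (weakHalfSpaceWalks d n).image F ⊆ T ×ˢ finsetsOfSumLE n := by
    intro p hp
    obtain ⟨ω, hω, rfl⟩ := Finset.mem_image.1 hp
    exact Finset.mem_product.2 ⟨Finset.mem_filter.2 ⟨unfold_mem_saws (hW hω),
      ((maxLevel_mem_Icc (hW hω)).1).trans (maxLevel_le_unfold_last (hW hω))⟩,
      code_mem_finsetsOfSumLE (hW hω)⟩
  have step3 : ∑ p ∈ (weakHalfSpaceWalks d n).image F, y ^ (p.1 n 0).toNat ≤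
      ∑ p ∈ T ×ˢ finsetsOfSumLE n, y ^ (p.1 n 0).toNat :=
    Finset.sum_le_sum_of_subset_of_nonneg hsub fun _ _ _ => pow_nonneg hy0.le _
  -- (4) the product sum is `#codes · Σ_T`
  have step4 : ∑ p ∈ T ×ˢ finsetsOfSumLE n, y ^ (p.1 n 0).toNat =
      ((finsetsOfSumLE n).card : ℝ) * ∑ β ∈ T, y ^ (β n 0).toNat := by
    rw [Finset.sum_product, Finset.mul_sum]
    refine Finset.sum_congr rfl fun β _ => ?_
    show ∑ _c ∈ finsetsOfSumLE n, y ^ (β n 0).toNat = _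
    rw [Finset.sum_const, nsmul_eq_mul]
  -- (5) `Σ_T y^{x₁(β_n)} ≤ Z_n(log y)`
  have step5 : ∑ β ∈ T, y ^ (β n 0).toNat ≤ driftZ d n (Real.log y) := by
    have h := sum_pow_le_driftZ_of_subset hTs hTpos (Real.log y)
    rwa [Real.exp_log hy0] at h
  calc pulledSpanU d n y ≤ ∑ ω ∈ weakHalfSpaceWalks d n, y ^ (unfold n ω n 0).toNat := step1
    _ = ∑ p ∈ (weakHalfSpaceWalks d n).image F, y ^ (p.1 n 0).toNat := step2
    _ ≤ ∑ p ∈ T ×ˢ finsetsOfSumLE n, y ^ (p.1 n 0).toNat := step3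
    _ = ((finsetsOfSumLE n).card : ℝ) * ∑ β ∈ T, y ^ (β n 0).toNat := step4
    _ ≤ ((finsetsOfSumLE n).card : ℝ) * driftZ d n (Real.log y) :=
        mul_le_mul_of_nonneg_left step5 (Nat.cast_nonneg _)

/-- `Z_n(θ) ≥ 0`. [cite: JansevanRensburgWhittington2016, §1] -/
theorem driftZ_nonneg (n : ℕ) (θ : ℝ) : 0 ≤ driftZ d n θ := by
  unfold driftZ
  exact Finset.sum_nonneg fun _ _ => (Real.exp_pos _).le

/-- **`C_n(1,y) ≤ e^{3√n} · Z_n(log y)` for `y ≥ 1`** (with the tree's code bound `#{codes} ≤ e^{3√n}`).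
[cite: JansevanRensburgWhittington2016, Theorem 3 (proof: "at most e^{O(√n)} such walks give the same bridge")] -/
theorem pulledSpanU_le_exp_mul_driftZ (n : ℕ) {y : ℝ} (hy : 1 ≤ y) :
    pulledSpanU d n y ≤ Real.exp (3 * Real.sqrt n) * driftZ d n (Real.log y) :=
  (pulledSpanU_le_card_mul_driftZ n hy).trans
    (mul_le_mul_of_nonneg_right (card_finsetsOfSumLE_le_exp n) (driftZ_nonneg n _))

end Span

section SpanLimit

variable {d : ℕ}

/-- **The printed shape `C_n(1,y) ≤ e^{O(√n)} B(y)`-bound, explicit, up to one extra step**: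
`C_n(1,y) ≤ (n+1) · e^{3√n + 6√(n+1)} · Z^B_{n+1}(y)` for `y ≥ 1`, every dimension `d + 1 ≥ 1` (chain
`pulledSpanU_le_exp_mul_driftZ` with the tree's `Z_n(θ) ≤ (n+1) e^{6√(n+1)} Z^B_{n+1}(e^θ)`).
[cite: JansevanRensburgWhittington2016, Theorem 3 (proof: "C_n(1,y) ≤ e^{O(√n)} B_n(y)")] -/
theorem pulledSpanU_le_mul_pulledBridgeZ_succ (d n : ℕ) {y : ℝ} (hy : 1 ≤ y) :
    pulledSpanU (d + 1) n y ≤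
      (n + 1) * Real.exp (3 * Real.sqrt n + 6 * Real.sqrt (n + 1)) * pulledBridgeZ (d + 1) (n + 1) y := by
  have hy0 : 0 < y := zero_lt_one.trans_le hy
  have hθ : 0 ≤ Real.log y := Real.log_nonneg hy
  have h1 := pulledSpanU_le_exp_mul_driftZ (d := d + 1) n hy
  have h2 := driftZ_le_mul_exp_mul_pulledBridgeZ_succ (d := d) n hθ
  rw [Real.exp_log hy0] at h2
  calc pulledSpanU (d + 1) n y ≤ Real.exp (3 * Real.sqrt n) * driftZ (d + 1) n (Real.log y) := h1
    _ ≤ Real.exp (3 * Real.sqrt n) *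
          ((n + 1) * Real.exp (6 * Real.sqrt (n + 1)) * pulledBridgeZ (d + 1) (n + 1) y) :=
        mul_le_mul_of_nonneg_left h2 (Real.exp_pos _).le
    _ = (n + 1) * Real.exp (3 * Real.sqrt n + 6 * Real.sqrt (n + 1)) * pulledBridgeZ (d + 1) (n + 1) y := by
        rw [Real.exp_add]; ring

/-- **The span-weighted free energy exists and equals `λ_B`**: `n⁻¹ log C_n(1,y) → λ_B(y)` for `y ≥ 1`, every
dimension `d + 1 ≥ 1` (squeeze between `U_n(y) ≤ C_n(1,y) ≤ e^{3√n} Z_n(log y)`, both ends having free energy `λ_B`).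
[cite: JansevanRensburgWhittington2016, Theorem 3] -/
theorem tendsto_log_pulledSpanU_div (d : ℕ) {y : ℝ} (hy : 1 ≤ y) :
    Tendsto (fun n : ℕ => Real.log (pulledSpanU (d + 1) n y) / n) atTop
      (𝓝 (pulledBridgeFreeEnergy (d + 1) y)) := by
  have hy0 : 0 < y := zero_lt_one.trans_le hy
  have hθ : 0 ≤ Real.log y := Real.log_nonneg hy
  have hU := tendsto_log_pulledU_div d hy
  have hZ : Tendsto (fun n : ℕ => Real.log (driftZ (d + 1) n (Real.log y)) / n) atTop
      (𝓝 (pulledBridgeFreeEnergy (d + 1) y)) := by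
    have := tendsto_log_driftZ_div d hθ
    rwa [Real.exp_log hy0] at this
  have hUpos : ∀ n, 0 < pulledU (d + 1) n y := fun n =>
    (pulledBridgeZ_pos d n hy0).trans_le (pulledBridgeZ_le_pulledU n hy0.le)
  have hCpos : ∀ n, 0 < pulledSpanU (d + 1) n y := fun n =>
    (hUpos n).trans_le (pulledU_le_pulledSpanU n hy)
  have hZpos : ∀ n, 0 < driftZ (d + 1) n (Real.log y) := fun n =>
    (hUpos n).trans_le (pulledU_le_driftZ n hy0)
  -- `√n / n → 0`
  have hsqrt : Tendsto (fun n : ℕ => Real.sqrt n / (n : ℝ)) atTop (𝓝 0) := by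
    have h : Tendsto (fun n : ℕ => (Real.sqrt (n : ℝ))⁻¹) atTop (𝓝 0) :=
      tendsto_inv_atTop_zero.comp (Real.tendsto_sqrt_atTop.comp tendsto_natCast_atTop_atTop)
    refine h.congr fun n => ?_
    rw [Real.sqrt_div_self]
  -- upper sequence `3 √n / n + log Z_n / n → 0 + λ_B`
  have hup : Tendsto (fun n : ℕ => 3 * (Real.sqrt n / (n : ℝ)) +
      Real.log (driftZ (d + 1) n (Real.log y)) / n) atTop (𝓝 (pulledBridgeFreeEnergy (d + 1) y)) := by
    have := (hsqrt.const_mul 3).add hZ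
    simpa using this
  refine tendsto_of_tendsto_of_tendsto_of_le_of_le' hU hup (Eventually.of_forall fun n => ?_) ?_
  · exact div_le_div_of_nonneg_right (Real.log_le_log (hUpos n) (pulledU_le_pulledSpanU n hy))
      (Nat.cast_nonneg n)
  · filter_upwards [eventually_gt_atTop 0] with n hn
    have hnr : (0 : ℝ) < n := by exact_mod_cast hn
    have h1 := pulledSpanU_le_exp_mul_driftZ (d := d + 1) n hy
    have h2 : Real.log (pulledSpanU (d + 1) n y) ≤
        3 * Real.sqrt n + Real.log (driftZ (d + 1) n (Real.log y)) := by
      have := Real.log_le_log (hCpos n) h1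
      rwa [Real.log_mul (Real.exp_pos _).ne' (hZpos n).ne', Real.log_exp] at this
    have h3 := div_le_div_of_nonneg_right h2 hnr.le
    refine h3.trans (le_of_eq ?_)
    rw [add_div, mul_div_assoc]

/-! ### Radius of convergence from the free energy (Cauchy–Hadamard, root-test form; private copies of the
helpers of `SAWPulledEnsembleEquivalence.lean`) -/

/-- If `a_N > 0` and `N⁻¹ log a_N → λ`, then `Σ_N a_N r^N` converges for `0 ≤ r < e^{-λ}`. [folklore] -/
private theorem summable_mul_pow_of_tendsto_log_div' {a : ℕ → ℝ} {lam r : ℝ} (ha : ∀ N, 0 < a N)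
    (h : Tendsto (fun N : ℕ => Real.log (a N) / N) atTop (𝓝 lam)) (hr0 : 0 ≤ r)
    (hr : r < Real.exp (-lam)) : Summable fun N => a N * r ^ N := by
  rcases hr0.eq_or_lt with rfl | hr0'
  · refine summable_of_ne_finset_zero (s := {0}) fun N hN => ?_
    rw [Finset.mem_singleton] at hN
    simp [zero_pow hN]
  have hlog : Real.log r < -lam := by
    have := Real.log_lt_log hr0' hr
    rwa [Real.log_exp] at this
  set ε : ℝ := (-lam - Real.log r) / 2 with hε
  have hεpos : 0 < ε := by rw [hε]; linarith
  set q : ℝ := Real.exp (lam + ε) * r with hq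
  have hq0 : 0 ≤ q := mul_nonneg (Real.exp_pos _).le hr0
  have hq1 : q < 1 := by
    have : Real.log q < 0 := by
      rw [hq, Real.log_mul (Real.exp_pos _).ne' hr0'.ne', Real.log_exp]; linarith
    have hqpos : 0 < q := mul_pos (Real.exp_pos _) hr0'
    have := Real.exp_lt_exp.2 this
    rwa [Real.exp_log hqpos, Real.exp_zero] at this
  have hgeom : Summable fun N : ℕ => q ^ N := summable_geometric_of_lt_one hq0 hq1
  have hev : ∀ᶠ N : ℕ in atTop, Real.log (a N) / N < lam + ε :=
    h (Iio_mem_nhds (by linarith))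
  refine Summable.of_norm_bounded_eventually_nat hgeom ?_
  filter_upwards [hev, eventually_gt_atTop 0] with N hN hNpos
  have hNr : (0 : ℝ) < N := by exact_mod_cast hNpos
  rw [Real.norm_of_nonneg (mul_nonneg (ha N).le (pow_nonneg hr0 N))]
  have h1 : Real.log (a N) < N * (lam + ε) := by
    rwa [div_lt_iff₀ hNr, mul_comm] at hN
  have h2 : a N < Real.exp (lam + ε) ^ N := by
    rw [← Real.exp_nat_mul, ← Real.exp_log (ha N)]
    exact Real.exp_lt_exp.2 h1
  calc a N * r ^ N ≤ Real.exp (lam + ε) ^ N * r ^ N :=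
        mul_le_mul_of_nonneg_right h2.le (pow_nonneg hr0 N)
    _ = q ^ N := by rw [hq, mul_pow]

/-- If `a_N > 0` and `N⁻¹ log a_N → λ`, then `Σ_N a_N r^N` diverges for `r > e^{-λ}`. [folklore] -/
private theorem not_summable_mul_pow_of_tendsto_log_div' {a : ℕ → ℝ} {lam r : ℝ} (ha : ∀ N, 0 < a N)
    (h : Tendsto (fun N : ℕ => Real.log (a N) / N) atTop (𝓝 lam))
    (hr : Real.exp (-lam) < r) : ¬ Summable fun N => a N * r ^ N := by
  have hr0 : 0 < r := (Real.exp_pos _).trans hr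
  have hlog : -lam < Real.log r := by
    have := Real.log_lt_log (Real.exp_pos _) hr
    rwa [Real.log_exp] at this
  set ε : ℝ := (lam + Real.log r) / 2 with hε
  have hεpos : 0 < ε := by rw [hε]; linarith
  intro hsum
  have hzero := hsum.tendsto_atTop_zero
  have hev : ∀ᶠ N : ℕ in atTop, lam - ε < Real.log (a N) / N :=
    h (Ioi_mem_nhds (by linarith))
  have hev2 : ∀ᶠ N : ℕ in atTop, (1 : ℝ) ≤ a N * r ^ N := by
    filter_upwards [hev, eventually_gt_atTop 0] with N hN hNpos
    have hNr : (0 : ℝ) < N := by exact_mod_cast hNpos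
    have h1 : N * (lam - ε) < Real.log (a N) := by
      rwa [lt_div_iff₀ hNr, mul_comm] at hN
    have h2 : Real.exp (lam - ε) ^ N < a N := by
      rw [← Real.exp_nat_mul, ← Real.exp_log (ha N)]
      exact Real.exp_lt_exp.2 h1
    have hq1 : 1 ≤ Real.exp (lam - ε) * r := by
      have : 0 ≤ Real.log (Real.exp (lam - ε) * r) := by
        rw [Real.log_mul (Real.exp_pos _).ne' hr0.ne', Real.log_exp]; linarith
      have hpos : 0 < Real.exp (lam - ε) * r := mul_pos (Real.exp_pos _) hr0
      have := Real.exp_le_exp.2 this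
      rwa [Real.exp_zero, Real.exp_log hpos] at this
    calc (1 : ℝ) ≤ (Real.exp (lam - ε) * r) ^ N := one_le_pow₀ hq1
      _ = Real.exp (lam - ε) ^ N * r ^ N := mul_pow _ _ _
      _ ≤ a N * r ^ N := mul_le_mul_of_nonneg_right h2.le (pow_nonneg hr0.le N)
  have hlt : ∀ᶠ N : ℕ in atTop, a N * r ^ N < 1 := hzero (Iio_mem_nhds zero_lt_one)
  obtain ⟨N, h1, h2⟩ := (hev2.and hlt).exists
  linarith

/-- **Janse van Rensburg–Whittington 2016, Theorem 3, AS PRINTED, for the printed triple of ensembles**, every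
dimension `d + 1 ≥ 1`: "The radii of convergence of the generating functions `C(y,z)`, `C⁺(y,z)` and `B(y,z)` are
all equal when `y ≥ 1`." Here `C(y,z) = Σ_n C_n(1,y) zⁿ` with `C_n(1,y) = pulledSpanU` (positive walks, weight
`y^{span}`), `C⁺(y,z) = Σ_n C⁺_n(1,y) zⁿ` with `C⁺_n(1,y) = U_n(y) = pulledU` (positive walks, weight `y^{height of
the last vertex}`), `B(y,z) = Σ_n B_n(y) zⁿ` with `B_n(y) = Σ_h b_n(h) y^h = pulledBridgeZ` (bridges): for `y ≥ 1`
all three series CONVERGE for `0 ≤ z < e^{-λ_B(y)}` and DIVERGE for `z > e^{-λ_B(y)}`, i.e. the three radii are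
equal (to `e^{-λ_B(y)}`, `λ_B = pulledBridgeFreeEnergy`). Printed proof: inclusions `B ≤ C⁺ ≤ C` and unfolding
`C_n(1,y) ≤ e^{O(√n)} B_n(y)`; here: the three free energies equal `λ_B` (`tendsto_pulledBridgeFreeEnergy`,
`tendsto_log_pulledU_div`, `tendsto_log_pulledSpanU_div`) and Cauchy–Hadamard. (The tree's strict-half-space and
drift ensembles: `JansevanRensburgWhittington2016_thm3_bridge_height` in `SAWPulledEnsembleEquivalence.lean`.)
[cite: JansevanRensburgWhittington2016, Theorem 3 (J. Phys. A 49 (2016) 11LT01, p. 4; arXiv:1510.06698 p0005:L22–L49)] -/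
theorem JansevanRensburgWhittington2016_thm3 (d : ℕ) {y : ℝ} (hy : 1 ≤ y) :
    (∀ z : ℝ, 0 ≤ z → z < Real.exp (-pulledBridgeFreeEnergy (d + 1) y) →
        Summable (fun n : ℕ => pulledSpanU (d + 1) n y * z ^ n) ∧
        Summable (fun n : ℕ => pulledU (d + 1) n y * z ^ n) ∧
        Summable (fun n : ℕ => pulledBridgeZ (d + 1) n y * z ^ n)) ∧
    (∀ z : ℝ, Real.exp (-pulledBridgeFreeEnergy (d + 1) y) < z →
        ¬ Summable (fun n : ℕ => pulledSpanU (d + 1) n y * z ^ n) ∧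
        ¬ Summable (fun n : ℕ => pulledU (d + 1) n y * z ^ n) ∧
        ¬ Summable (fun n : ℕ => pulledBridgeZ (d + 1) n y * z ^ n)) := by
  have hy0 : 0 < y := zero_lt_one.trans_le hy
  have hB : ∀ n, 0 < pulledBridgeZ (d + 1) n y := fun n => pulledBridgeZ_pos d n hy0
  have hU : ∀ n, 0 < pulledU (d + 1) n y := fun n =>
    (hB n).trans_le (pulledBridgeZ_le_pulledU n hy0.le)
  have hC : ∀ n, 0 < pulledSpanU (d + 1) n y := fun n =>
    (hU n).trans_le (pulledU_le_pulledSpanU n hy)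
  have tB := tendsto_pulledBridgeFreeEnergy d hy0
  have tU := tendsto_log_pulledU_div d hy
  have tC := tendsto_log_pulledSpanU_div d hy
  refine ⟨fun z hz0 hz => ⟨?_, ?_, ?_⟩, fun z hz => ⟨?_, ?_, ?_⟩⟩
  · exact summable_mul_pow_of_tendsto_log_div' hC tC hz0 hz
  · exact summable_mul_pow_of_tendsto_log_div' hU tU hz0 hz
  · exact summable_mul_pow_of_tendsto_log_div' hB tB hz0 hz
  · exact not_summable_mul_pow_of_tendsto_log_div' hC tC hz
  · exact not_summable_mul_pow_of_tendsto_log_div' hU tU hz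
  · exact not_summable_mul_pow_of_tendsto_log_div' hB tB hz

end SpanLimit

end Zd


/-! ## The pushed phase, Beaton's eq. (3): `λ(y) = log μ` for `0 < y ≤ 1`, every `d ≥ 2` — by opening the
## self-avoiding polygons at a lowest point (Madras–Slade (3.2.1), proof of Proposition 8.1.2) -/

namespace Zd

section PushedLoops

variable {d : ℕ}

/-- Properties of a closed self-avoiding loop (`saLoops`; the tree's membership lemma for `nnWalks` is
file-private, so the forward direction is re-derived here). [cite: MadrasSlade1993, §3.3, proof of Lemma 3.3.3 (p. 73)] -/
private theorem saLoops_props {a : ℕ} {ω : ℕ → Site d} (hω : ω ∈ saLoops d a) :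
    ω 0 = 0 ∧ (∀ i, a ≤ i → ω i = ω a) ∧ (∀ i < a, (zdGraph d).Adj (ω i) (ω (i + 1))) ∧
      ω a = 0 ∧ Set.InjOn ω {i | i < a} := by
  classical
  obtain ⟨hnn, hend, hinj⟩ := mem_saLoops.1 hω
  rw [nnWalks, Finset.mem_filter] at hnn
  obtain ⟨hfr, h0, hadj⟩ := hnn
  refine ⟨h0, fun i hi => ?_, hadj, hend, hinj⟩
  rw [frozenFns, Finset.mem_image] at hfr
  obtain ⟨f, -, rfl⟩ := hfr
  simp only [min_eq_right hi, min_self]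

/-- **Opening a polygon at a root**: the closed loop `ω` of length `a`, re-rooted at time `r` and read for
`a - 1` steps (the last bond dropped), translated to start at `0`: `s ↦ ω((r+s) mod a) - ω(r)` — "one of the
`2N` self-avoiding walks corresponding to the polygon in the sense of Definition 3.2.1".
[cite: MadrasSlade1993, §8.1, proof of Proposition 8.1.2 (p. 261); Definition 3.2.1, eq. (3.2.1) (p. 65)] -/
def rerootOpen (a r : ℕ) (ω : ℕ → Site d) : ℕ → Site d :=
  fun s => ω ((r + min s (a - 1)) % a) - ω r

/-- Values of the opened loop up to time `a - 1`. [cite: MadrasSlade1993, Definition 3.2.1] -/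
private theorem rerootOpen_apply_of_le {a r s : ℕ} (ω : ℕ → Site d) (hs : s ≤ a - 1) :
    rerootOpen a r ω s = ω ((r + s) % a) - ω r := by
  simp [rerootOpen, min_eq_left hs]

/-- The opened re-rooted loop is an `(a-1)`-step self-avoiding walk from `0`.
[cite: MadrasSlade1993, §8.1, proof of Proposition 8.1.2 (p. 261: "ω is one of the 2N self-avoiding walks corresponding to the polygon")] -/
theorem rerootOpen_mem_saws {a r : ℕ} {ω : ℕ → Site d} (hω : ω ∈ saLoops d a) (hr : r < a) :
    rerootOpen a r ω ∈ saws d (a - 1) := by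
  obtain ⟨h0, -, hadj, hend, hinj⟩ := saLoops_props hω
  have ha : 0 < a := by omega
  have hr' : r % a = r := Nat.mod_eq_of_lt hr
  refine mem_saws.2 ⟨by simp [rerootOpen, hr'], fun i hi => by simp [rerootOpen, min_eq_right hi], ?_, ?_⟩
  · intro s hs
    rw [rerootOpen_apply_of_le ω hs.le, rerootOpen_apply_of_le ω (by omega), zdGraph_adj_sub_right]
    have hmod : (r + (s + 1)) % a = ((r + s) % a + 1) % a := by
      rw [← add_assoc, Nat.add_mod (r + s) 1 a]
      rcases Nat.eq_or_lt_of_le (Nat.succ_le_of_lt ha) with h1 | h1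
      · subst h1; simp
      · rw [Nat.mod_eq_of_lt h1]
    rw [hmod]
    set t := (r + s) % a with ht
    have hta : t < a := Nat.mod_lt _ ha
    rcases Nat.lt_or_ge (t + 1) a with h1 | h1
    · rw [Nat.mod_eq_of_lt h1]
      exact hadj t hta
    · have hta' : t + 1 = a := le_antisymm (Nat.succ_le_of_lt hta) h1
      rw [hta', Nat.mod_self, h0, ← hend, ← hta']
      exact hadj t hta
  · intro s₁ hs₁ s₂ hs₂ heq
    simp only [Set.mem_setOf_eq] at hs₁ hs₂
    rw [rerootOpen_apply_of_le ω hs₁, rerootOpen_apply_of_le ω hs₂, sub_left_inj] at heq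
    have h1 : (r + s₁) % a < a := Nat.mod_lt _ ha
    have h2 : (r + s₂) % a < a := Nat.mod_lt _ ha
    have h3 : (r + s₁) % a = (r + s₂) % a := hinj h1 h2 heq
    have h4 : s₁ % a = s₂ % a := Nat.ModEq.add_left_cancel' r h3
    rwa [Nat.mod_eq_of_lt (by omega : s₁ < a), Nat.mod_eq_of_lt (by omega : s₂ < a)] at h4

/-- Rooted at a time of MINIMAL first coordinate, the opened loop lies in the weak half-space `x₁ ≥ 0`
("Observe that such a polygon lies in the half-space `x₁ ≥ 0`").
[cite: MadrasSlade1993, §8.1, proof of Proposition 8.1.2 (p. 261)] -/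
theorem rerootOpen_apply_zero_nonneg [NeZero d] {a r : ℕ} {ω : ℕ → Site d} (hr : r < a)
    (hmin : ∀ t < a, ω r 0 ≤ ω t 0) (s : ℕ) : 0 ≤ rerootOpen a r ω s 0 := by
  simp only [rerootOpen, Pi.sub_apply, sub_nonneg]
  exact hmin _ (Nat.mod_lt _ (by omega))

/-- The endpoint of the opened loop is adjacent to its starting point `0` (it was joined to the root by the
dropped bond). [cite: MadrasSlade1993, §8.1, proof of Proposition 8.1.2 (p. 261: "u = ω(N-1) - y is a unit vector")] -/
theorem rerootOpen_last_adj {a r : ℕ} {ω : ℕ → Site d} (hω : ω ∈ saLoops d a) (ha : 1 ≤ a) (hr : r < a) :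
    (zdGraph d).Adj (rerootOpen a r ω (a - 1)) 0 := by
  obtain ⟨h0, -, hadj, hend, -⟩ := saLoops_props hω
  rw [rerootOpen_apply_of_le ω le_rfl]
  rcases Nat.eq_zero_or_pos r with rfl | hrpos
  · rw [zero_add, Nat.mod_eq_of_lt (by omega : a - 1 < a), h0, sub_zero]
    have := hadj (a - 1) (by omega)
    rwa [Nat.sub_add_cancel ha, hend] at this
  · have e : (r + (a - 1)) % a = r - 1 := by
      rw [show r + (a - 1) = (r - 1) + a by omega, Nat.add_mod_right, Nat.mod_eq_of_lt (by omega)]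
    rw [e]
    have := hadj (r - 1) (by omega)
    rw [Nat.sub_add_cancel hrpos] at this
    have h := (zdGraph_adj_sub_right (ω (r - 1)) (ω r) (ω r)).2 this
    rwa [sub_self] at h

/-- Hence its endpoint height is `0` or `1` when the root is a lowest point.
[cite: MadrasSlade1993, §8.1, proof of Proposition 8.1.2 (p. 261)] -/
theorem rerootOpen_last_le_one [NeZero d] {a r : ℕ} {ω : ℕ → Site d} (hω : ω ∈ saLoops d a) (ha : 1 ≤ a)
    (hr : r < a) :
    rerootOpen a r ω (a - 1) 0 ≤ 1 := by
  have h := abs_le.1 (abs_sub_le_one_of_adj (rerootOpen_last_adj hω ha hr) 0)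
  simp only [Pi.zero_apply] at h
  linarith [h.1]

/-- The loop is recovered from its root time and its opened walk.
[cite: MadrasSlade1993, Definition 3.2.1 ("2N self-avoiding walks correspond to each N-step polygon")] -/
theorem eq_of_rerootOpen_eq {a r : ℕ} {ω₁ ω₂ : ℕ → Site d} (h₁ : ω₁ ∈ saLoops d a) (h₂ : ω₂ ∈ saLoops d a)
    (hr : r < a) (h : rerootOpen a r ω₁ = rerootOpen a r ω₂) : ω₁ = ω₂ := by
  obtain ⟨h0₁, hfr₁, -, hend₁, -⟩ := saLoops_props h₁
  obtain ⟨h0₂, hfr₂, -, hend₂, -⟩ := saLoops_props h₂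
  -- the roots agree
  have hc : ω₁ r = ω₂ r := by
    rcases Nat.eq_zero_or_pos r with rfl | hrpos
    · rw [h0₁, h0₂]
    · have := congrFun h (a - r)
      rw [rerootOpen_apply_of_le ω₁ (by omega), rerootOpen_apply_of_le ω₂ (by omega),
        Nat.add_sub_cancel' hr.le, Nat.mod_self, h0₁, h0₂, zero_sub, zero_sub, neg_inj] at this
      exact this
  have hlt : ∀ t < a, ω₁ t = ω₂ t := by
    intro t ht
    obtain ⟨s, hs, hst⟩ : ∃ s, s ≤ a - 1 ∧ (r + s) % a = t := by
      rcases le_or_gt r t with hrt | hrt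
      · exact ⟨t - r, by omega, by rw [Nat.add_sub_cancel' hrt, Nat.mod_eq_of_lt ht]⟩
      · refine ⟨t + a - r, by omega, ?_⟩
        rw [show r + (t + a - r) = t + a by omega, Nat.add_mod_right, Nat.mod_eq_of_lt ht]
    have := congrFun h s
    rw [rerootOpen_apply_of_le ω₁ hs, rerootOpen_apply_of_le ω₂ hs, hst, hc, sub_left_inj] at this
    exact this
  funext t
  rcases Nat.lt_or_ge t a with ht | ht
  · exact hlt t ht
  · rw [hfr₁ t ht, hfr₂ t ht, hend₁, hend₂]

end PushedLoops

section Pushed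

variable {d : ℕ} [NeZero d]

/-- **The opened polygons rooted at their last lowest point**: `ω ↦ rerootOpen a (lastMin (a-1) ω) ω`.
[cite: MadrasSlade1993, §8.1, proof of Proposition 8.1.2 (p. 261)] -/
def openAtMin (a : ℕ) (ω : ℕ → Site d) : ℕ → Site d :=
  rerootOpen a (lastMin (a - 1) ω) ω

/-- The opened polygon rooted at a lowest point is a weak-half-space walk of length `a - 1` with endpoint
height `≤ 1`. [cite: MadrasSlade1993, §8.1, proof of Proposition 8.1.2 (p. 261)] -/
theorem openAtMin_mem {a : ℕ} {ω : ℕ → Site d} (hω : ω ∈ saLoops d a) (ha : 1 ≤ a) :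
    openAtMin a ω ∈ weakHalfSpaceWalks d (a - 1) ∧ openAtMin a ω (a - 1) 0 ≤ 1 := by
  have hr : lastMin (a - 1) ω < a := lt_of_le_of_lt (lastMin_le _ _) (by omega)
  have hmin : ∀ t < a, ω (lastMin (a - 1) ω) 0 ≤ ω t 0 := fun t ht => apply_lastMin_le (by omega)
  exact ⟨mem_weakHalfSpaceWalks.2 ⟨rerootOpen_mem_saws hω hr,
    fun s _ => rerootOpen_apply_zero_nonneg hr hmin s⟩, rerootOpen_last_le_one hω ha hr⟩

open Classical in
/-- **At most `a` polygons (with distinguished site and orientation) open to the same walk**: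
`#saLoops(a) ≤ a · #{openAtMin a ω : ω ∈ saLoops(a)}` (the root time determines the loop).
[cite: MadrasSlade1993, Definition 3.2.1, eq. (3.2.1) (p. 65: "2N q_N")] -/
theorem card_saLoops_le_mul_card_image_openAtMin (a : ℕ) (ha : 1 ≤ a) :
    (saLoops d a).card ≤ a * ((saLoops d a).image (openAtMin a)).card := by
  classical
  have h := Finset.card_le_card_of_injOn (s := saLoops d a)
    (t := Finset.range a ×ˢ (saLoops d a).image (openAtMin a))
    (fun ω => (lastMin (a - 1) ω, openAtMin a ω)) (fun ω hω => ?_) ?_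
  · rwa [Finset.card_product, Finset.card_range] at h
  · rw [Finset.mem_coe] at hω
    simp only [Finset.mem_coe, Finset.mem_product, Finset.mem_range]
    exact ⟨lt_of_le_of_lt (lastMin_le _ _) (by omega), Finset.mem_image_of_mem _ hω⟩
  · intro ω₁ h₁ ω₂ h₂ heq
    simp only [Prod.mk.injEq] at heq
    have hr : lastMin (a - 1) ω₁ < a := lt_of_le_of_lt (lastMin_le _ _) (by omega)
    refine eq_of_rerootOpen_eq h₁ h₂ hr ?_
    have h2 := heq.2
    simp only [openAtMin] at h2
    rw [heq.1] at h2 ⊢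
    exact h2

/-- **Odd lengths: `y · #saLoops(a) ≤ a · U_{a-1}(y)` for `0 < y ≤ 1`** — every opened polygon is a
weak-half-space walk of weight `y^h ≥ y` (`h ∈ {0,1}`).
[cite: Beaton2015, §2, eq. (3) (p. 3: "U_n(0) = u_n(0) is the number of half-space SAWs which start and end on the surface, and the growth rate of such objects is the same as that of full- and half-space SAWs [Hammersley1982]"); MadrasSlade1993, §8.1, proof of Proposition 8.1.2] -/
theorem mul_card_saLoops_le_mul_pulledU {a : ℕ} (ha : 1 ≤ a) {y : ℝ} (hy0 : 0 ≤ y) (hy1 : y ≤ 1) :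
    y * (saLoops d a).card ≤ a * pulledU d (a - 1) y := by
  classical
  set I := (saLoops d a).image (openAtMin a) with hI
  have hsub : I ⊆ weakHalfSpaceWalks d (a - 1) := by
    intro σ hσ
    obtain ⟨ω, hω, rfl⟩ := Finset.mem_image.1 hσ
    exact (openAtMin_mem hω ha).1
  have h1 : y * (I.card : ℝ) ≤ pulledU d (a - 1) y := by
    unfold pulledU
    calc y * (I.card : ℝ) = ∑ _σ ∈ I, y := by rw [Finset.sum_const, nsmul_eq_mul, mul_comm]
      _ ≤ ∑ σ ∈ I, y ^ (σ (a - 1) 0).toNat := Finset.sum_le_sum fun σ hσ => by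
          obtain ⟨ω, hω, rfl⟩ := Finset.mem_image.1 hσ
          have hle : (openAtMin a ω (a - 1) 0).toNat ≤ 1 := by
            have := (openAtMin_mem hω ha).2
            omega
          calc y = y ^ 1 := (pow_one y).symm
            _ ≤ y ^ (openAtMin a ω (a - 1) 0).toNat := pow_le_pow_of_le_one hy0 hy1 hle
      _ ≤ ∑ σ ∈ weakHalfSpaceWalks d (a - 1), y ^ (σ (a - 1) 0).toNat :=
          Finset.sum_le_sum_of_subset_of_nonneg hsub fun _ _ _ => pow_nonneg hy0 _
  have h2 : ((saLoops d a).card : ℝ) ≤ a * (I.card : ℝ) := by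
    exact_mod_cast card_saLoops_le_mul_card_image_openAtMin (d := d) a ha
  calc y * ((saLoops d a).card : ℝ) ≤ y * (a * (I.card : ℝ)) := mul_le_mul_of_nonneg_left h2 hy0
    _ = a * (y * (I.card : ℝ)) := by ring
    _ ≤ a * pulledU d (a - 1) y := mul_le_mul_of_nonneg_left h1 (Nat.cast_nonneg a)

omit [NeZero d] in
/-- Dropping the last step of an `(n+1)`-step self-avoiding walk (the tree's `loopTrunc`) gives an `n`-step
self-avoiding walk. [cite: MadrasSlade1993, §1.2] -/
private theorem loopTrunc_succ_mem_saws {n : ℕ} {σ : ℕ → Site d} (hσ : σ ∈ saws d (n + 1)) :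
    loopTrunc (n + 1) σ ∈ saws d n := by
  obtain ⟨h0, -, hadj, hinj⟩ := mem_saws.1 hσ
  have happ : ∀ s, loopTrunc (n + 1) σ s = σ (min s n) := fun s => by simp [loopTrunc]
  refine mem_saws.2 ⟨by rw [happ, Nat.zero_min, h0], fun i hi => by rw [happ, happ, min_eq_right hi, min_self],
    fun i hi => ?_, fun i hi j hj hij => ?_⟩
  · rw [happ, happ, min_eq_left hi.le, min_eq_left (by omega : i + 1 ≤ n)]
    exact hadj i (by omega)
  · simp only [Set.mem_setOf_eq] at hi hj
    rw [happ, happ, min_eq_left hi, min_eq_left hj] at hij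
    exact hinj (show i ∈ {k | k ≤ n + 1} by simp only [Set.mem_setOf_eq]; omega)
      (show j ∈ {k | k ≤ n + 1} by simp only [Set.mem_setOf_eq]; omega) hij

omit [NeZero d] in
open Classical in
/-- Dropping the last step is at most `3^d`-to-one on `(n+1)`-step self-avoiding walks (the last step is a
vector of `[-1,1]^d`). [cite: MadrasSlade1993, §1.2, eq. (1.2.3) (c_{N+1} ≤ 2d c_N-type counting)] -/
private theorem card_le_mul_card_image_loopTrunc {n : ℕ} {S : Finset (ℕ → Site d)} (hS : S ⊆ saws d (n + 1)) :
    S.card ≤ 3 ^ d * (S.image (loopTrunc (n + 1))).card := by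
  classical
  have h := Finset.card_le_card_of_injOn (s := S)
    (t := box d 1 ×ˢ S.image (loopTrunc (n + 1)))
    (fun σ => (σ (n + 1) - σ n, loopTrunc (n + 1) σ)) (fun σ hσ => ?_) ?_
  · rwa [Finset.card_product, card_box, show 2 * 1 + 1 = 3 by rfl] at h
  · rw [Finset.mem_coe] at hσ
    obtain ⟨-, -, hadj, -⟩ := mem_saws.1 (hS hσ)
    simp only [Finset.mem_coe, Finset.mem_product]
    refine ⟨mem_box.2 fun i => ?_, Finset.mem_image_of_mem _ hσ⟩
    have := abs_le.1 (abs_sub_le_one_of_adj (hadj n (Nat.lt_succ_self n)) i)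
    simp only [Pi.sub_apply, Nat.cast_one]
    exact this
  · intro σ₁ h₁ σ₂ h₂ heq
    simp only [Prod.mk.injEq] at heq
    obtain ⟨hstep, htr⟩ := heq
    obtain ⟨-, hfr₁, -, -⟩ := mem_saws.1 (hS h₁)
    obtain ⟨-, hfr₂, -, -⟩ := mem_saws.1 (hS h₂)
    have hle : ∀ s ≤ n, σ₁ s = σ₂ s := fun s hs => by
      have := congrFun htr s
      simpa [loopTrunc, min_eq_left hs] using this
    have hn1 : σ₁ (n + 1) = σ₂ (n + 1) := by
      have := hle n le_rfl
      rw [this] at hstep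
      exact sub_left_inj.1 hstep
    funext t
    rcases Nat.lt_or_ge t (n + 1) with ht | ht
    · exact hle t (by omega)
    · rw [hfr₁ t ht, hfr₂ t ht, hn1]

/-- **Even lengths: `y² · #saLoops(a) ≤ a · 3^d · U_{a-2}(y)` for `0 < y ≤ 1`, `a ≥ 2`** — open the polygon
at a lowest point and drop one more step (endpoint height `≤ 2`, weight `≥ y²`).
[cite: Beaton2015, §2, eq. (3); MadrasSlade1993, §8.1, proof of Proposition 8.1.2] -/
theorem sq_mul_card_saLoops_le_mul_pulledU {a : ℕ} (ha : 2 ≤ a) {y : ℝ} (hy0 : 0 ≤ y) (hy1 : y ≤ 1) :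
    y ^ 2 * (saLoops d a).card ≤ a * 3 ^ d * pulledU d (a - 2) y := by
  classical
  obtain ⟨n, hn⟩ : ∃ n, a - 1 = n + 1 := ⟨a - 2, by omega⟩
  have hn2 : a - 2 = n := by omega
  set I := (saLoops d a).image (openAtMin a) with hI
  set J := I.image (loopTrunc (n + 1)) with hJ
  have hIs : I ⊆ saws d (n + 1) := by
    intro σ hσ
    obtain ⟨ω, hω, rfl⟩ := Finset.mem_image.1 hσ
    have := weakHalfSpaceWalks_subset_saws _ (openAtMin_mem hω (by omega)).1
    rwa [hn] at this
  -- the twice-opened polygons are weak-half-space walks of length `a - 2` with endpoint height `≤ 2`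
  have hJw : ∀ τ ∈ J, τ ∈ weakHalfSpaceWalks d n ∧ τ n 0 ≤ 2 := by
    intro τ hτ
    obtain ⟨σ, hσ, rfl⟩ := Finset.mem_image.1 hτ
    obtain ⟨ω, hω, rfl⟩ := Finset.mem_image.1 hσ
    obtain ⟨hw, hlast⟩ := openAtMin_mem hω (by omega : 1 ≤ a)
    rw [hn] at hw hlast
    obtain ⟨hs, hpos⟩ := mem_weakHalfSpaceWalks.1 hw
    have happ : ∀ s, loopTrunc (n + 1) (openAtMin a ω) s = openAtMin a ω (min s n) := fun s => by
      simp [loopTrunc]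
    refine ⟨mem_weakHalfSpaceWalks.2 ⟨loopTrunc_succ_mem_saws hs, fun i hi => ?_⟩, ?_⟩
    · rw [happ, min_eq_left hi]; exact hpos i (by omega)
    · rw [happ, min_self]
      obtain ⟨-, -, hadj, -⟩ := mem_saws.1 hs
      have h := abs_le.1 (abs_sub_le_one_of_adj (hadj n (Nat.lt_succ_self n)) 0)
      linarith [h.1, hlast]
  have hJsub : J ⊆ weakHalfSpaceWalks d n := fun τ hτ => (hJw τ hτ).1
  have h1 : y ^ 2 * (J.card : ℝ) ≤ pulledU d n y := by
    unfold pulledU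
    calc y ^ 2 * (J.card : ℝ) = ∑ _τ ∈ J, y ^ 2 := by rw [Finset.sum_const, nsmul_eq_mul, mul_comm]
      _ ≤ ∑ τ ∈ J, y ^ (τ n 0).toNat := Finset.sum_le_sum fun τ hτ => by
          have hle : (τ n 0).toNat ≤ 2 := by have := (hJw τ hτ).2; omega
          exact pow_le_pow_of_le_one hy0 hy1 hle
      _ ≤ ∑ τ ∈ weakHalfSpaceWalks d n, y ^ (τ n 0).toNat :=
          Finset.sum_le_sum_of_subset_of_nonneg hJsub fun _ _ _ => pow_nonneg hy0 _
  have h2 : ((saLoops d a).card : ℝ) ≤ a * (I.card : ℝ) := by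
    exact_mod_cast card_saLoops_le_mul_card_image_openAtMin (d := d) a (by omega)
  have h3 : (I.card : ℝ) ≤ 3 ^ d * (J.card : ℝ) := by
    exact_mod_cast card_le_mul_card_image_loopTrunc hIs
  rw [hn2]
  calc y ^ 2 * ((saLoops d a).card : ℝ) ≤ y ^ 2 * (a * (3 ^ d * (J.card : ℝ))) :=
        mul_le_mul_of_nonneg_left (h2.trans (mul_le_mul_of_nonneg_left h3 (Nat.cast_nonneg a)))
          (pow_nonneg hy0 2)
    _ = a * 3 ^ d * (y ^ 2 * (J.card : ℝ)) := by ring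
    _ ≤ a * 3 ^ d * pulledU d n y := mul_le_mul_of_nonneg_left h1 (by positivity)

/-- `U_n(y) ≤ c_n` for `0 ≤ y ≤ 1` (every weight `y^h ≤ 1`). [cite: Beaton2015, §2 (p. 3: "u_n ≤ c_n")] -/
theorem pulledU_le_count (n : ℕ) {y : ℝ} (hy0 : 0 ≤ y) (hy1 : y ≤ 1) : pulledU d n y ≤ count d n := by
  unfold pulledU
  calc ∑ ω ∈ weakHalfSpaceWalks d n, y ^ (ω n 0).toNat ≤ ∑ _ω ∈ weakHalfSpaceWalks d n, (1 : ℝ) :=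
        Finset.sum_le_sum fun _ _ => pow_le_one₀ hy0 hy1
    _ = (weakHalfSpaceWalks d n).card := by simp
    _ ≤ (saws d n).card := by exact_mod_cast Finset.card_le_card (weakHalfSpaceWalks_subset_saws n)
    _ = count d n := by rw [card_saws]

/-- **A uniform lower bound in the pushed phase**: for `d ≥ 2` and `0 < y ≤ 1` there is `C` with
`y² μ^{n-2} e^{-C√n} / ((n+2) 3^d) ≤ U_n(y)` for every `n ≥ 3` (from `μ^{2M} e^{-C√M} ≤ #saLoops(2M+2)`,
`exp_mul_pow_le_card_saLoops`, and the two opening bounds above, by parity of `n`).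
[cite: Beaton2015, §2, eq. (3); MadrasSlade1993, Corollary 3.2.5, eq. (3.2.9) (μ_Polygon = μ)] -/
theorem pulledU_lower_of_le_one (hd : 2 ≤ d) {y : ℝ} (hy0 : 0 < y) (hy1 : y ≤ 1) :
    ∃ C : ℝ, 0 ≤ C ∧ ∀ n : ℕ, 3 ≤ n →
      y ^ 2 * connectiveConstant d ^ (n - 2) * Real.exp (-(C * Real.sqrt n)) / ((n + 2) * 3 ^ d) ≤
        pulledU d n y := by
  obtain ⟨C, hC⟩ := exp_mul_pow_le_card_saLoops (d := d) hd
  set μ := connectiveConstant d with hμdef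
  have hμ1 : 1 ≤ μ := one_le_connectiveConstant d
  refine ⟨max C 0, le_max_right _ _, fun n hn => ?_⟩
  have hy2 : 0 ≤ y ^ 2 := pow_nonneg hy0.le 2
  have h3d : (0 : ℝ) < 3 ^ d := by positivity
  have hn0 : (0 : ℝ) < (n : ℝ) + 2 := by positivity
  -- `e^{-max(C,0) √n} ≤ e^{-C √M}` whenever `M ≤ n`
  have hexp : ∀ M : ℕ, M ≤ n → Real.exp (-(max C 0 * Real.sqrt n)) ≤ Real.exp (-(C * Real.sqrt M)) := by
    intro M hM
    apply Real.exp_le_exp.2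
    have h1 : C * Real.sqrt M ≤ max C 0 * Real.sqrt M :=
      mul_le_mul_of_nonneg_right (le_max_left _ _) (Real.sqrt_nonneg _)
    have h2 : max C 0 * Real.sqrt M ≤ max C 0 * Real.sqrt n :=
      mul_le_mul_of_nonneg_left (Real.sqrt_le_sqrt (by exact_mod_cast hM)) (le_max_right _ _)
    linarith
  rw [div_le_iff₀ (by positivity)]
  rcases Nat.even_or_odd n with ⟨M, hM⟩ | ⟨M, hM⟩
  · -- even `n = 2M`: use the loops of length `n + 2 = 2M + 2` (so `M ≥ 2 ≥ 1`)
    have hM1 : 1 ≤ M := by omega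
    have hloops := hC M hM1
    have hopen := sq_mul_card_saLoops_le_mul_pulledU (d := d) (a := 2 * M + 2) (by omega) hy0.le hy1
    rw [show 2 * M + 2 - 2 = n by omega] at hopen
    have hpow : μ ^ (n - 2) ≤ μ ^ (2 * M) := pow_le_pow_right₀ hμ1 (by omega)
    calc y ^ 2 * μ ^ (n - 2) * Real.exp (-(max C 0 * Real.sqrt n))
        ≤ y ^ 2 * (μ ^ (2 * M) * Real.exp (-(C * Real.sqrt M))) := by
          rw [mul_assoc]
          exact mul_le_mul_of_nonneg_left (mul_le_mul hpow (hexp M (by omega)) (Real.exp_pos _).le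
            (pow_nonneg (zero_le_one.trans hμ1) _)) hy2
      _ ≤ y ^ 2 * ((saLoops d (2 * M + 2)).card : ℝ) := mul_le_mul_of_nonneg_left hloops hy2
      _ ≤ (2 * M + 2 : ℕ) * 3 ^ d * pulledU d n y := by exact_mod_cast hopen
      _ = pulledU d n y * ((n : ℝ) + 2) * 3 ^ d := by push_cast; rw [hM]; push_cast; ring
      _ = pulledU d n y * (((n : ℝ) + 2) * 3 ^ d) := by ring
  · -- odd `n = 2M + 1`: use the loops of length `n + 1 = 2M + 2` (`M ≥ 1`)
    have hM1 : 1 ≤ M := by omega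
    have hloops := hC M hM1
    have hopen := mul_card_saLoops_le_mul_pulledU (d := d) (a := 2 * M + 2) (by omega) hy0.le hy1
    rw [show 2 * M + 2 - 1 = n by omega] at hopen
    have hpow : μ ^ (n - 2) ≤ μ ^ (2 * M) := pow_le_pow_right₀ hμ1 (by omega)
    have hyy : y ^ 2 ≤ y := by
      have := mul_le_mul_of_nonneg_left hy1 hy0.le
      rwa [mul_one, ← pow_two] at this
    have hU0 : 0 ≤ pulledU d n y := Finset.sum_nonneg fun _ _ => pow_nonneg hy0.le _
    calc y ^ 2 * μ ^ (n - 2) * Real.exp (-(max C 0 * Real.sqrt n))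
        ≤ y * (μ ^ (2 * M) * Real.exp (-(C * Real.sqrt M))) := by
          rw [mul_assoc]
          exact mul_le_mul hyy (mul_le_mul hpow (hexp M (by omega)) (Real.exp_pos _).le
            (pow_nonneg (zero_le_one.trans hμ1) _)) (by positivity) hy0.le
      _ ≤ y * ((saLoops d (2 * M + 2)).card : ℝ) := mul_le_mul_of_nonneg_left hloops hy0.le
      _ ≤ (2 * M + 2 : ℕ) * pulledU d n y := by exact_mod_cast hopen
      _ = pulledU d n y * ((n : ℝ) + 1) := by push_cast; rw [hM]; push_cast; ring
      _ ≤ pulledU d n y * (((n : ℝ) + 2) * 3 ^ d) := by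
          apply mul_le_mul_of_nonneg_left _ hU0
          have : (1 : ℝ) ≤ 3 ^ d := one_le_pow₀ (by norm_num)
          nlinarith

end Pushed

section PushedLimit

/-- **Beaton 2015, eq. (3) — the pushed phase, for `0 < y ≤ 1`, every dimension `d + 2 ≥ 2`:
`n⁻¹ log U_n(y) → log μ`** ("`λ(y) = κ` for `0 ≤ y ≤ 1`"; printed via `λ(1) = κ`, `λ(0) = κ`
[Hammersley1982: walks returning to the surface grow like `μⁿ`] and monotonicity; here by the sandwich
`y² μ^{n-2} e^{-C√n}/((n+2)3^d) ≤ U_n(y) ≤ c_n`, the lower bound from opening the self-avoiding polygons at a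
lowest point — the printed mechanism of Madras–Slade's Proposition 8.1.2 — and `μ_Polygon = μ`). The value
`y = 0` (walks ending exactly on the surface) and `d = 1` (where `U_n(y) = yⁿ` and the statement fails) are
not covered. [cite: Beaton2015, §2, eq. (3) (p. 3, L27); MadrasSlade1993, Proposition 8.1.2 (proof) and Corollary 3.2.5] -/
theorem tendsto_log_pulledU_div_of_le_one (d : ℕ) {y : ℝ} (hy0 : 0 < y) (hy1 : y ≤ 1) :
    Tendsto (fun n : ℕ => Real.log (pulledU (d + 2) n y) / n) atTop
      (𝓝 (Real.log (connectiveConstant (d + 2)))) := by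
  set μ := connectiveConstant (d + 2) with hμdef
  have hμ : 0 < μ := connectiveConstant_pos (d + 2)
  obtain ⟨C, hC0, hC⟩ := pulledU_lower_of_le_one (d := d + 2) (by omega) hy0 hy1
  have hUpos : ∀ n, 0 < pulledU (d + 2) n y := fun n =>
    (pulledBridgeZ_pos (d + 1) n hy0).trans_le (pulledBridgeZ_le_pulledU n hy0.le)
  -- upper sequence `log c_n / n → log μ`
  have hup : Tendsto (fun n : ℕ => Real.log (count (d + 2) n) / n) atTop (𝓝 (Real.log μ)) := by
    have h := ((Real.continuousAt_log hμ.ne').tendsto).comp (tendsto_count_rpow (d + 2))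
    refine h.congr' ?_
    filter_upwards [eventually_gt_atTop 0] with n hn
    have hc : (0 : ℝ) < count (d + 2) n := by exact_mod_cast one_le_count (d + 2) n
    simp only [Function.comp]
    rw [Real.log_rpow hc, one_div, inv_mul_eq_div]
  -- `√n / n → 0`
  have hsqrt : Tendsto (fun n : ℕ => Real.sqrt n / (n : ℝ)) atTop (𝓝 0) := by
    have h : Tendsto (fun n : ℕ => (Real.sqrt (n : ℝ))⁻¹) atTop (𝓝 0) :=
      tendsto_inv_atTop_zero.comp (Real.tendsto_sqrt_atTop.comp tendsto_natCast_atTop_atTop)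
    refine h.congr fun n => ?_
    rw [Real.sqrt_div_self]
  -- lower sequence `log μ + K/n - (C+2) √n/n → log μ`, `K = 2 log y - 2 log μ - d' log 3` a constant
  set K : ℝ := 2 * Real.log y - 2 * Real.log μ - Real.log (3 ^ (d + 2)) with hK
  have hlow : Tendsto (fun n : ℕ => Real.log μ + K * (1 / (n : ℝ)) - (C + 4) * (Real.sqrt n / (n : ℝ)))
      atTop (𝓝 (Real.log μ)) := by
    have h1 : Tendsto (fun n : ℕ => K * (1 / (n : ℝ))) atTop (𝓝 0) := by
      simpa using (tendsto_const_div_atTop_nhds_zero_nat (1 : ℝ)).const_mul K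
    have h2 : Tendsto (fun n : ℕ => (C + 4) * (Real.sqrt n / (n : ℝ))) atTop (𝓝 0) := by
      simpa using hsqrt.const_mul (C + 4)
    have := (h1.const_add (Real.log μ)).sub h2
    simpa using this
  refine tendsto_of_tendsto_of_tendsto_of_le_of_le' hlow hup ?_ (Eventually.of_forall fun n => ?_)
  · filter_upwards [eventually_ge_atTop 3] with n hn
    have hnr : (0 : ℝ) < n := by exact_mod_cast (show 0 < n by omega)
    have hn2 : (0 : ℝ) < (n : ℝ) + 2 := by positivity
    have hb := hC n hn
    -- the logarithm of the lower bound
    have eA : Real.log (y ^ 2 * μ ^ (n - 2) * Real.exp (-(C * Real.sqrt n))) =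
        2 * Real.log y + ((n : ℝ) - 2) * Real.log μ - C * Real.sqrt n := by
      rw [Real.log_mul (by positivity) (by positivity), Real.log_mul (by positivity) (by positivity),
        Real.log_exp, Real.log_pow, Real.log_pow, Nat.cast_sub (by omega : 2 ≤ n)]
      push_cast
      ring
    have eB : Real.log (((n : ℝ) + 2) * 3 ^ (d + 2)) = Real.log ((n : ℝ) + 2) + Real.log (3 ^ (d + 2)) :=
      Real.log_mul (by positivity) (by positivity)
    have hlogb : 2 * Real.log y + ((n : ℝ) - 2) * Real.log μ - C * Real.sqrt n -
        (Real.log ((n : ℝ) + 2) + Real.log (3 ^ (d + 2))) ≤ Real.log (pulledU (d + 2) n y) := by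
      have hpos : 0 < y ^ 2 * μ ^ (n - 2) * Real.exp (-(C * Real.sqrt n)) / (((n : ℝ) + 2) * 3 ^ (d + 2)) := by
        positivity
      have := Real.log_le_log hpos hb
      rwa [Real.log_div (by positivity) (by positivity), eA, eB] at this
    -- `log(n+2) ≤ 4 √n` for `n ≥ 3`
    have hn3 : (3 : ℝ) ≤ n := by exact_mod_cast hn
    have hlogn : Real.log ((n : ℝ) + 2) ≤ 4 * Real.sqrt n := by
      have h1 := Real.log_le_rpow_div hn2.le (by norm_num : (0 : ℝ) < 1 / 2)
      rw [← Real.sqrt_eq_rpow] at h1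
      have h2 : Real.sqrt ((n : ℝ) + 2) ≤ Real.sqrt (4 * n) := Real.sqrt_le_sqrt (by linarith)
      have h3 : Real.sqrt (4 * (n : ℝ)) = 2 * Real.sqrt n := by
        rw [Real.sqrt_mul (by norm_num), show (4 : ℝ) = 2 ^ 2 by norm_num, Real.sqrt_sq (by norm_num)]
      have h4 : Real.sqrt ((n : ℝ) + 2) / (1 / 2) = 2 * Real.sqrt ((n : ℝ) + 2) := by ring
      rw [h4] at h1
      linarith
    rw [le_div_iff₀ hnr]
    have hq : (Real.log μ + K * (1 / (n : ℝ)) - (C + 4) * (Real.sqrt n / (n : ℝ))) * n =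
        (n : ℝ) * Real.log μ + K - (C + 4) * Real.sqrt n := by
      field_simp
    rw [hq, hK]
    nlinarith [hlogb, hlogn]
  · exact div_le_div_of_nonneg_right
      (Real.log_le_log (hUpos n) (pulledU_le_count n hy0.le hy1)) (Nat.cast_nonneg n)

/-- **Beaton 2015, Theorem 1, AS PRINTED IN FULL — `y_c = 1` — every dimension `d + 2 ≥ 2`:** with
`λ(y) = lim n⁻¹ log U_n(y)` (Beaton's pulled weak-half-space walks), (i) for `0 < y ≤ 1` the limit exists and
equals `κ = log μ` (eq. (3), the pushed phase), and (ii) for every `y > 1` the limit exists and is `> log μ`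
(§3, eq. (8)); hence "the critical fugacity `y_c` for pulled SAWs in a half-space of the `d`-dimensional
hypercubic lattice is `y_c = 1`" (p. 3, L39–L40). Not covered: `y = 0` and `d = 1`.
[cite: Beaton2015, Theorem 1 (p. 3, L39–L40), eq. (3) (L27), §3 eq. (8)] -/
theorem Beaton2015_thm1 (d : ℕ) :
    (∀ y : ℝ, 0 < y → y ≤ 1 →
        Tendsto (fun n : ℕ => Real.log (pulledU (d + 2) n y) / n) atTop
          (𝓝 (Real.log (connectiveConstant (d + 2))))) ∧
    (∀ y : ℝ, 1 < y → ∃ lam : ℝ, Real.log (connectiveConstant (d + 2)) < lam ∧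
        Tendsto (fun n : ℕ => Real.log (pulledU (d + 2) n y) / n) atTop (𝓝 lam)) :=
  ⟨fun _ hy0 hy1 => tendsto_log_pulledU_div_of_le_one d hy0 hy1, Beaton2015_thm1_gt_one (d + 1)⟩

end PushedLimit

end Zd


/-! ## Beaton's standing facts of §2 as theorems: the free energy exists for every `y > 0` and equals
## `max(log μ, λ_B(y))`; eq. (4) `λ(y) ≥ log y`; `λ_B(1) = log μ` -/

namespace Zd

section StandingFacts

variable {d : ℕ} [NeZero d]

/-- The straight walk in the `+x₁` direction is a bridge (private copy of the tree's
`Zd.straightWalk_mem_bridges` of `SAWTubeConnectors.lean`, not imported here).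
[cite: MadrasSlade1993, Definition 1.2.4; Beaton2015, §2 (p. 3: "for each n there is a walk with length and height n")] -/
private theorem straightWalk_mem_bridges' (n : ℕ) : straightWalk d n ∈ bridges d n := by
  refine mem_bridges.2 ⟨straightWalk_mem_saws d n, fun i hi1 hi2 => ?_⟩
  simp only [straightWalk, Pi.single_eq_same, min_eq_left hi2, min_self, Nat.zero_min, Nat.cast_zero]
  exact ⟨by exact_mod_cast hi1, by exact_mod_cast hi2⟩

/-- `Z^B_n(y) ≥ yⁿ` for `y ≥ 0` (the straight bridge has span `n`).
[cite: Beaton2015, §2, eq. (4) (p. 3, L29–L32: "U_n(y) ≥ yⁿ. Thus λ(y) ≥ log y")] -/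
theorem pow_le_pulledBridgeZ (n : ℕ) {y : ℝ} (hy : 0 ≤ y) : y ^ n ≤ pulledBridgeZ d n y := by
  classical
  rw [pulledBridgeZ_eq_sum_bridges]
  have h := Finset.single_le_sum (f := fun β : ℕ → Site d => y ^ (β n 0).toNat)
    (fun _ _ => pow_nonneg hy _) (straightWalk_mem_bridges' (d := d) n)
  have e : (straightWalk d n n 0).toNat = n := by simp [straightWalk]
  simpa [e] using h

/-- `Z^B_n(y)` is non-decreasing in `y ≥ 0`. [cite: Beaton2015, §2 (p. 3, L23: "U_n(y) is clearly a non-decreasing function of y")] -/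
theorem pulledBridgeZ_mono_right (n : ℕ) {y y' : ℝ} (hy : 0 ≤ y) (hyy : y ≤ y') :
    pulledBridgeZ d n y ≤ pulledBridgeZ d n y' := by
  rw [pulledBridgeZ_eq_sum_bridges, pulledBridgeZ_eq_sum_bridges]
  exact Finset.sum_le_sum fun β _ => pow_le_pow_left₀ hy hyy _

end StandingFacts

section StandingFactsLimit

/-- **Beaton's eq. (4) for the bridge free energy: `log y ≤ λ_B(y)`**, every `y > 0`, every `ℤ^{d+1}`.
[cite: Beaton2015, §2, eq. (4) (p. 3, L29–L32)] -/
theorem log_le_pulledBridgeFreeEnergy (d : ℕ) {y : ℝ} (hy : 0 < y) :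
    Real.log y ≤ pulledBridgeFreeEnergy (d + 1) y :=
  log_le_pulledBridgeFreeEnergy_of_geometric d hy one_pos hy fun N => by
    rw [one_mul]; exact pow_le_pulledBridgeZ N hy.le

/-- **`λ_B` is non-decreasing on `(0, ∞)`.** [cite: Beaton2015, §2 (p. 3, L23–L24: "the same also holds for λ(y)")] -/
theorem pulledBridgeFreeEnergy_mono (d : ℕ) {y y' : ℝ} (hy : 0 < y) (hyy : y ≤ y') :
    pulledBridgeFreeEnergy (d + 1) y ≤ pulledBridgeFreeEnergy (d + 1) y' := by
  have hy' : 0 < y' := hy.trans_le hyy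
  refine le_of_tendsto_of_tendsto' (tendsto_pulledBridgeFreeEnergy d hy) (tendsto_pulledBridgeFreeEnergy d hy')
    fun N => div_le_div_of_nonneg_right ?_ (Nat.cast_nonneg N)
  exact Real.log_le_log (pulledBridgeZ_pos d N hy) (pulledBridgeZ_mono_right N hy.le hyy)

/-- **`λ_B(1) = log μ`** (`Z^B_N(1) = b_N` and `μ_Bridge = μ`): the two phases of Beaton's Theorem 1 agree at
`y = 1`. [cite: Beaton2015, §2, eq. (2)–(3) (p. 3: "λ(1) = κ"); MadrasSlade1993, Corollary 3.1.8 (μ_Bridge = μ)] -/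
theorem pulledBridgeFreeEnergy_one (d : ℕ) :
    pulledBridgeFreeEnergy (d + 1) 1 = Real.log (connectiveConstant (d + 1)) := by
  have hμ : 0 < connectiveConstant (d + 1) := connectiveConstant_pos (d + 1)
  have h1 := tendsto_pulledBridgeFreeEnergy d one_pos
  -- `Z^B_N(1) = b_N`
  have hZ : ∀ N, pulledBridgeZ (d + 1) N 1 = bridgeCount (d + 1) N := fun N => by
    classical
    rw [pulledBridgeZ_eq_sum_bridges, bridgeCount]
    simp
  -- `log b_N / N → log μ`
  have h2 : Tendsto (fun N : ℕ => Real.log (pulledBridgeZ (d + 1) N 1) / N) atTop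
      (𝓝 (Real.log (connectiveConstant (d + 1)))) := by
    have h := ((Real.continuousAt_log hμ.ne').tendsto).comp (tendsto_bridgeCount_rpow (d := d + 1))
    refine h.congr' ?_
    filter_upwards [eventually_gt_atTop 0] with N hN
    have hb : (0 : ℝ) < bridgeCount (d + 1) N := by exact_mod_cast one_le_bridgeCount N
    simp only [Function.comp]
    rw [Real.log_rpow hb, one_div, inv_mul_eq_div, hZ]
  exact tendsto_nhds_unique h1 h2

/-- **Beaton's free energy EXISTS for every `y > 0` and equals `max(log μ, λ_B(y))`**, every `ℤ^{d+2}` — the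
printed standing fact "It is proved in [vanRensburg2009Thermodynamics] that the free energy
`λ(y) = lim n⁻¹ log U_n(y)` exists" together with the printed phase picture (5): `λ(y) = κ` for `y ≤ y_c = 1`,
`λ(y) = λ_B(y) > κ` for `y > 1`. [cite: Beaton2015, §2 (p. 3, L21–L22 and display (5), L34–L35); Theorem 1] -/
theorem Beaton2015_freeEnergy (d : ℕ) {y : ℝ} (hy : 0 < y) :
    Tendsto (fun n : ℕ => Real.log (pulledU (d + 2) n y) / n) atTop
      (𝓝 (max (Real.log (connectiveConstant (d + 2))) (pulledBridgeFreeEnergy (d + 2) y))) := by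
  rcases le_total y 1 with hy1 | hy1
  · -- pushed phase: the limit is `log μ`, and `λ_B(y) ≤ λ_B(1) = log μ`
    have hle : pulledBridgeFreeEnergy (d + 2) y ≤ Real.log (connectiveConstant (d + 2)) := by
      rw [← pulledBridgeFreeEnergy_one (d + 1)]
      exact pulledBridgeFreeEnergy_mono (d + 1) hy hy1
    rw [max_eq_left hle]
    exact tendsto_log_pulledU_div_of_le_one d hy hy1
  · -- pulled phase: the limit is `λ_B(y) ≥ λ_B(1) = log μ`
    have hge : Real.log (connectiveConstant (d + 2)) ≤ pulledBridgeFreeEnergy (d + 2) y := by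
      rw [← pulledBridgeFreeEnergy_one (d + 1)]
      exact pulledBridgeFreeEnergy_mono (d + 1) one_pos hy1
    rw [max_eq_right hge]
    exact tendsto_log_pulledU_div (d + 1) hy1

/-- **The free energy exists** (`∃ λ`, every `y > 0`, every `ℤ^{d+2}`).
[cite: Beaton2015, §2 (p. 3, L21–L22: "the free energy λ(y) = lim_{n→∞} n⁻¹ log U_n(y) exists")] -/
theorem Beaton2015_freeEnergy_exists (d : ℕ) {y : ℝ} (hy : 0 < y) :
    ∃ lam : ℝ, Tendsto (fun n : ℕ => Real.log (pulledU (d + 2) n y) / n) atTop (𝓝 lam) :=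
  ⟨_, Beaton2015_freeEnergy d hy⟩

/-- **Beaton's eq. (4): `λ(y) ≥ log y`** for the half-space free energy, every `y > 0`, every `ℤ^{d+2}`.
[cite: Beaton2015, §2, eq. (4) (p. 3, L29–L32)] -/
theorem Beaton2015_eq4 (d : ℕ) {y : ℝ} (hy : 0 < y) :
    Real.log y ≤ max (Real.log (connectiveConstant (d + 2))) (pulledBridgeFreeEnergy (d + 2) y) :=
  (log_le_pulledBridgeFreeEnergy (d + 1) hy).trans (le_max_right _ _)

end StandingFactsLimit

end Zd

end Literature.Probability.RandomPlanarGeometry.SAW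

end
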